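import Literature.Analysis.Calculus.SmoothArzelaAscoli
import HarnessLib

/-!
# The `C^∞` Arzelà–Ascoli theorem for sequences smooth on an exhaustion (eventually defined maps)

Sequences of maps which are only EVENTUALLY smooth and bounded on each member of an increasing open
exhaustion `U₀ ⊆ U₁ ⊆ ⋯`, `⋃ Uⱼ = U` — the situation of time-translates `f(· + tₙ)` of a map
defined for `t > t₀`, which are defined on `{t > t₀ − tₙ}` only — still have `C^∞_loc`-convergent
subsequences on `U`:

**Theorem (`exists_strictMono_contDiffOn_infty_tendstoUniformlyOn_iteratedFDeriv_of_exhaustion`).**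
Let `U j` be open and increasing with union `U`, and `f : ℕ → E → F` with `f n` smooth on `U j`
for `n ≥ j` and, for every `j`, every order `i` and every compact `K ⊆ U j`, a bound
`‖Dⁱ fₙ‖ ≤ Λ` on `K` for all `n ≥ j`. Then there are `φ` strictly increasing and `g` smooth on `U`
with `Dⁱ f_{φ n} → Dⁱ g` uniformly on every compact subset of `U`, for every `i`.

Proof: Cantor's diagonal (`DiagonalSubsequence.lean`) over the stages `j`, running the `C^∞`
Arzelà–Ascoli theorem (`SmoothArzelaAscoli.lean`) on `U j` for the tail `n ≥ j` of the current
subsequence; the stage limits `g_j` agree on overlaps (pointwise limits of one diagonal sequence)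
and glue to `g`.

## References
* [Petersen2006] P. Petersen, *Riemannian Geometry*, 2nd ed., GTM 171, Springer 2006, Ch. 10, §3.1.
* [Seregin2014] G. Seregin, *Lecture notes on regularity theory for the Navier–Stokes equations*,
  2014, App. B §B.4.
-/

noncomputable section

open Set Metric Filter Topology Function
open scoped ContDiff Topology

namespace Literature.Analysis.Calculus

open Literature.Analysis.FunctionSpaces

variable {E : Type*} [NormedAddCommGroup E] [NormedSpace ℝ E] [FiniteDimensional ℝ E]
  {F : Type*} [NormedAddCommGroup F] [NormedSpace ℝ F] [FiniteDimensional ℝ F]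

omit [NormedSpace ℝ E] [FiniteDimensional ℝ E] [FiniteDimensional ℝ F] in
/-- A compact subset of the union of an increasing sequence of open sets lies in one of them.
[folklore] -/
theorem exists_subset_of_isCompact_of_monotone {U : ℕ → Set E} (hUo : ∀ j, IsOpen (U j))
    (hUm : Monotone U) {K : Set E} (hK : IsCompact K) (hKU : K ⊆ ⋃ j, U j) : ∃ j, K ⊆ U j := by
  obtain ⟨T, hT⟩ := hK.elim_finite_subcover U hUo hKU
  refine ⟨T.sup id, hT.trans (iUnion₂_subset fun j hj ↦ hUm ?_)⟩
  exact Finset.le_sup (f := id) hj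

/-- **The `C^∞` Arzelà–Ascoli theorem on an exhaustion** (module docstring).
[cite: Petersen2006, Ch. 10 §3.1] -/
theorem exists_strictMono_contDiffOn_infty_tendstoUniformlyOn_iteratedFDeriv_of_exhaustion
    {U : ℕ → Set E} (hUo : ∀ j, IsOpen (U j)) (hUm : Monotone U) {f : ℕ → E → F}
    (hf : ∀ j n, j ≤ n → ContDiffOn ℝ ∞ (f n) (U j))
    (hb : ∀ (j i : ℕ), ∀ K ⊆ U j, IsCompact K →
      ∃ Λ : ℝ, ∀ n, j ≤ n → ∀ z ∈ K, ‖iteratedFDeriv ℝ i (f n) z‖ ≤ Λ) :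
    ∃ (g : E → F) (φ : ℕ → ℕ), StrictMono φ ∧ ContDiffOn ℝ ∞ g (⋃ j, U j) ∧
      ∀ (i : ℕ), ∀ K ⊆ ⋃ j, U j, IsCompact K → TendstoUniformlyOn
        (fun n ↦ iteratedFDeriv ℝ i (f (φ n))) (iteratedFDeriv ℝ i g) atTop K := by
  classical
  -- the stage property: `C^∞` convergence on compacts of `U j` to a map smooth on `U j`
  let P : ℕ → (ℕ → ℕ) → Prop := fun j ρ ↦ ∃ g : E → F, ContDiffOn ℝ ∞ g (U j) ∧
    ∀ (i : ℕ), ∀ K ⊆ U j, IsCompact K → TendstoUniformlyOn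
      (fun n ↦ iteratedFDeriv ℝ i (f (ρ n))) (iteratedFDeriv ℝ i g) atTop K
  have hsub : ∀ j (ρ ρ' : ℕ → ℕ), (∃ τ : ℕ → ℕ, StrictMono τ ∧ ∀ᶠ m in atTop, ρ' m = ρ (τ m)) →
      P j ρ → P j ρ' := by
    rintro j ρ ρ' ⟨τ, hτ, heq⟩ ⟨g, hg, hlim⟩
    exact ⟨g, hg, fun i K hKU hK ↦ tendstoUniformlyOn_of_eventually_eq_comp
      (G := fun n ↦ iteratedFDeriv ℝ i (f n)) hτ heq (hlim i K hKU hK)⟩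
  have hex : ∀ j (ρ : ℕ → ℕ), StrictMono ρ → ∃ ψ : ℕ → ℕ, StrictMono ψ ∧ P j (ρ ∘ ψ) := by
    intro j ρ hρ
    -- the tail `n ↦ f (ρ (n + j))` is smooth and bounded on `U j` (`ρ (n + j) ≥ j`)
    have hge : ∀ n, j ≤ ρ (n + j) := fun n ↦ (Nat.le_add_left j n).trans (hρ.id_le _)
    obtain ⟨g, ψ, hψ, hg, hlim⟩ :=
      exists_strictMono_contDiffOn_infty_tendstoUniformlyOn_iteratedFDeriv (hUo j)
        (f := fun n ↦ f (ρ (n + j))) (fun n ↦ hf j _ (hge n)) fun i K hKU hK ↦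
          (hb j i K hKU hK).imp fun Λ hΛ n z hz ↦ hΛ _ (hge n) z hz
    refine ⟨fun n ↦ ψ n + j, fun a b hab ↦ Nat.add_lt_add_right (hψ hab) j, g, hg, ?_⟩
    intro i K hKU hK
    exact hlim i K hKU hK
  obtain ⟨φ, hφ, hP⟩ := exists_strictMono_forall_of_extraction hsub hex
  choose g hg hlim using hP
  -- the stage limits agree on overlaps: pointwise limits of one sequence
  have hagree : ∀ j j' x, x ∈ U j → x ∈ U j' → g j x = g j' x := by
    intro j j' x hx hx'
    have t1 := tendsto_of_tendstoUniformlyOn_iteratedFDeriv_zero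
      (hlim j 0 {x} (singleton_subset_iff.2 hx) isCompact_singleton)
    have t2 := tendsto_of_tendstoUniformlyOn_iteratedFDeriv_zero
      (hlim j' 0 {x} (singleton_subset_iff.2 hx') isCompact_singleton)
    exact tendsto_nhds_unique t1 t2
  -- glue
  let G : E → F := fun x ↦ if h : ∃ j, x ∈ U j then g (Nat.find h) x else 0
  have hG : ∀ j, ∀ x ∈ U j, G x = g j x := by
    intro j x hx
    have h : ∃ j, x ∈ U j := ⟨j, hx⟩
    simp only [G, dif_pos h]
    exact hagree _ _ x (Nat.find_spec h) hx
  have hGev : ∀ j, ∀ x ∈ U j, G =ᶠ[𝓝 x] g j := fun j x hx ↦ by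
    filter_upwards [(hUo j).mem_nhds hx] with y hy
    exact hG j y hy
  refine ⟨G, φ, hφ, ?_, fun i K hKU hK ↦ ?_⟩
  · intro x hx
    obtain ⟨j, hxj⟩ := mem_iUnion.1 hx
    have h1 : ContDiffAt ℝ ∞ (g j) x := (hg j).contDiffAt ((hUo j).mem_nhds hxj)
    exact (h1.congr_of_eventuallyEq (hGev j x hxj)).contDiffWithinAt
  · obtain ⟨j, hKj⟩ := exists_subset_of_isCompact_of_monotone hUo hUm hK hKU
    have hder : EqOn (iteratedFDeriv ℝ i (g j)) (iteratedFDeriv ℝ i G) K := fun x hx ↦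
      ((hGev j x (hKj hx)).symm.iteratedFDeriv ℝ i).eq_of_nhds
    exact (hlim j i K hKj hK).congr_right hder

end Literature.Analysis.Calculus

end
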